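import Summits.BirchSwinnertonDyer.BirchSwinnertonDyer.Theorems.AlignedTransportAtTwoMainConjectureOfRankZeroBSDAtTwoSexticKurodaExact
import Summits.BirchSwinnertonDyer.Rank1Residual.F1Sign2.AnalyticLineTransferAtTwo
import Literature.NumberTheory.IwasawaTheory.ClassicalMuVanishesSemidihedralDescent
import Mathlib.FieldTheory.Normal.Closure
import HarnessLib

/-!
# Route `AlignedTransportAtTwo`, crux C2 `MainConjectureOfRankZeroBSDAtTwo` (stmt-BirchSwinnertonDyer-22298):
# A SHARED CUBIC FIELD GIVES ONE SEXTIC — on crux C1's binders (`F` cubic, `e₁, e₂ ∈ F` roots of the two `u`-cubics)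
# `ℚ(W₁[2]) = ℚ(W₂[2])` in `ℚ̄`, `ℚ(β₁) ≃ F ≃ ℚ(β₂)`, and every Iwasawa input of C2 agrees on `W₁` and `W₂`

HONEST FRAMING. WIDTH-5 attached prover seat `bsd-line-att-p4` g31 on line `birth` of the lead `bsd-line-att-p2`; `--supports`
stmt-BirchSwinnertonDyer-22298, closes nothing; BSD is NOT proved; crux C2, its verdict «blocked-on
`Rank1Residual.GreenbergMuConjectureIrreducible`» and every registered stub untouched; crux C1 (stmt-…-22296) is only READ (its binders).
THEOREMS ONLY (no `def`, no named fact, no `sorry`).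

WHAT. Crux C1 `MainConjectureTransportAlignedAtTwo` speaks of two curves `W₁, W₂/ℚ` without rational `2`-torsion abscissa that SHARE A
CUBIC FIELD: a number field `F` with `[F : ℚ] = 3` and `e₁, e₂ ∈ F` roots of the `u`-cubics `u³ + b₂u² + 8b₄u + 16b₆` of `W₁`, `W₂`
(`Rank1Residual.F1Sign2.twoDivisionUCubic`, `u = 4x`). Crux C2's open inputs (road (b″): PFμ⁺ = Iwasawa's `μ₂ = 0` for `ℚ(W[2], i)`;
the sextic criterion; this lineage's `S₃` ledger `e_n(ℚ(W[2])) = e_n(ℚ(√Δ_W)) + 2·e_n(ℚ(β))`) are statements about the `2`-division field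
`T = ℚ(W[2]) ⊆ ℚ̄` and the cubic point fields `ℚ(β_j) = ℚ⟮x(T_j)⟯ ⊆ ℚ̄`. This file proves that ON C1's BINDERS these objects COINCIDE:

* §1 (one curve `W`, a cubic number field `F ∋ e` with `c_W(e) = 0`): `nonempty_algEquiv_adjoin_xT` — **`ℚ⟮x(T_j)⟯ ≃ₐ[ℚ] F`** for
  every `j` (`4·x(T_j)` and `e` have the same minimal polynomial `c_W`); `divisionField_two_eq_normalClosure` — **`ℚ(W[2])` is the
  normal closure of `F` in `ℚ̄`** (`= ⨆_{f : F →ₐ[ℚ] ℚ̄} f(F)`; att-p5 g6 `divisionField_two_eq_adjoin_rootSet` + the roots of `c_W` in `ℚ̄`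
  are the `f(e)`).
* §2 (C1's binders verbatim: `W₁, W₂`, `F`, `e₁, e₂`): ★★ `divisionField_two_eq_of_shared_cubic_field` — **`W₁.divisionField 2 = W₂.divisionField 2`**;
  ★ `nonempty_algEquiv_adjoin_xT_adjoin_xT` — `ℚ⟮x(T_j(W₁))⟯ ≃ₐ[ℚ] ℚ⟮x(T_j'(W₂))⟯` for all `j, j'`.
* §3 consequences in C2's currencies (cyclotomic `ℤ₂`-towers, any normalisations): `classNumberPExp_eq_adjoin_xT_of_root` (`e_n(F) = e_n(ℚ(β_j))`:
  the cubic input may be READ ON `F`) and `forall_classicalMuVanishes_iff_adjoin_xT_of_root`; `classNumberPExp_adjoin_xT_eq_of_shared_cubic_field`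
  (`e_n(ℚ(β₁)) = e_n(ℚ(β₂))` for all `n`), `forall_classicalMuVanishes_adjoin_xT_iff_of_shared_cubic_field` (H3M input);
  `classNumberPExp_divisionField_two_eq_of_shared_cubic_field` (`e_n(ℚ(W₁[2])) = e_n(ℚ(W₂[2]))`),
  `classicalMuVanishes_divisionField_two_iff_of_shared_cubic_field`, `classicalLambda_divisionField_two_eq_of_shared_cubic_field`,
  `forall_classicalMuVanishes_divisionField_two_iff_of_shared_cubic_field`; `forall_classicalMuVanishes_sup_iff_of_shared_cubic_field` and
  `classNumberPExp_sup_eq_of_shared_cubic_field` (the PFμ⁺ carrier `ℚ(W[2]) ⊔ K`, the registered stub's `K = ℚ⟮i⟯` VERBATIM); and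
  `classNumberPExp_resolvent_eq_of_shared_cubic_field` (`e_n(ℚ(√Δ₁)) = e_n(ℚ(√Δ₂))`, from this seat's exact `S₃` identity, g30 — no
  identification of the two resolvent fields needed).

READING (C2 input ledger / C1): every open Iwasawa input of road (b″) — H3M⁻ (`μ₂(ℚ(β))`, `Δ < 0`), CM6M⁺ (`μ₂(ℚ(β, i))`, `Δ > 0`), PFμ⁺,
the sextic `e_n/λ₂` table — is a function on the SET OF CUBIC FIELDS `{ℚ(β_W)}` up to isomorphism; C1's aligned pairs carry identical C2 inputs.
Field theory + transport only; BSD is not proved by any of this. References: [SilvermanAEC2009] III.§1, VIII.§1; [MilneFT2022] Ch. 3, 5;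
[Washington1997] §13.1; tree: att-p1 `…TransportAlignedAtTwoBridge` (same `u`-cubic bookkeeping; re-derived here so that this file imports no
`Theses` module), att-p5 g5/g6 `…FineRoadDivisionFieldRigidity` / `…DivisionCubic`, att-p4 g29/g30 `…SignFreeOneRoot` / `…SexticKurodaExact`,
cell bsd-potss `classNumberPExp_restrict_eq_of_algEquiv`, Mathlib `normalClosure`.
-/

-- the Theorems namespace of this sub repeats the summit name by design (D-0017 nested layout)
set_option linter.dupNamespace false
set_option autoImplicit false

noncomputable section

open scoped Classical NumberField

namespace Summit.BirchSwinnertonDyer.BirchSwinnertonDyer.Theorems.AlignedTransportAtTwoSharedCubicDivisionField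

open NumberField Polynomial WeierstrassCurve IntermediateField Field
  Literature.NumberTheory.EllipticCurves Literature.NumberTheory.EllipticCurves.Greenberg1999
  Literature.NumberTheory.EllipticCurves.DokchitserDokchitser2012
  Literature.NumberTheory.EllipticCurves.ZpExtension Literature.NumberTheory.GaloisRepresentations
  Literature.NumberTheory.IwasawaTheory Literature.NumberTheory.NumberFields
  Summit.BirchSwinnertonDyer.Rank1Residual.F1Sign2
  Summit.BirchSwinnertonDyer.BirchSwinnertonDyer.Theorems.AlignedTransportAtTwoFineRoad.DivisionCubic
  Summit.BirchSwinnertonDyer.BirchSwinnertonDyer.Theorems.AlignedTransportAtTwoSexticNormRelationDescentMu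
  Summit.BirchSwinnertonDyer.BirchSwinnertonDyer.Theorems.AlignedTransportAtTwoSexticNormRelationDescentSignFree
  Summit.BirchSwinnertonDyer.BirchSwinnertonDyer.Theorems.AlignedTransportAtTwoSexticNormRelationDescentSignFreeOneRoot
  Summit.BirchSwinnertonDyer.BirchSwinnertonDyer.Theorems.AlignedTransportAtTwoSexticKurodaExact

/-! ## §1 One curve and a cubic field containing a root of its `u`-cubic -/

section OneCurve

variable (W : WeierstrassCurve ℚ) [W.IsElliptic]

omit [W.IsElliptic] in
/-- **`c_W(4z) = 16·ψ_W(z)` in `ℚ̄`**: `z` is a root of the `2`-division cubic `ψ_W = 4x³ + b₂x² + 2b₄x + b₆` iff `4z` is a root of the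
`u`-cubic `c_W = u³ + b₂u² + 8b₄u + 16b₆` (`Rank1Residual.F1Sign2.twoDivisionUCubic`, C1's polynomial). [folklore] -/
theorem mem_rootSet_twoTorsionPolynomial_iff (z : AlgebraicClosure ℚ) :
    z ∈ W.twoTorsionPolynomial.toPoly.rootSet (AlgebraicClosure ℚ) ↔ aeval (4 * z) (twoDivisionUCubic W) = 0 := by
  rw [mem_rootSet_of_ne (twoTorsionPolynomial_toPoly_ne_zero W two_ne_zero)]
  have h1 : aeval z W.twoTorsionPolynomial.toPoly = 4 * z ^ 3 + (W.b₂ : AlgebraicClosure ℚ) * z ^ 2 +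
      2 * (W.b₄ : AlgebraicClosure ℚ) * z + (W.b₆ : AlgebraicClosure ℚ) := by
    simp only [WeierstrassCurve.twoTorsionPolynomial, Cubic.toPoly, map_add, map_mul, map_pow, aeval_X, aeval_C, eq_ratCast]
    push_cast; ring
  have h2 : aeval (4 * z) (twoDivisionUCubic W) = 16 * (4 * z ^ 3 + (W.b₂ : AlgebraicClosure ℚ) * z ^ 2 +
      2 * (W.b₄ : AlgebraicClosure ℚ) * z + (W.b₆ : AlgebraicClosure ℚ)) := by
    simp only [twoDivisionUCubic, map_add, map_mul, map_pow, aeval_X, aeval_C, eq_ratCast]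
    push_cast; ring
  rw [h1, h2, mul_eq_zero, or_iff_right (by norm_num)]

/-- **`4·x(T_j)` is a root of the `u`-cubic `c_W`.** [cite: SilvermanAEC2009, Ex. III.3.7 (d)] -/
theorem aeval_four_mul_xT_twoDivisionUCubic (j : Fin 3) :
    aeval (4 * xT W two_ne_zero j) (twoDivisionUCubic W) = 0 :=
  (mem_rootSet_twoTorsionPolynomial_iff W _).mp (xT_mem_rootSet W two_ne_zero j)

/-- `ℚ⟮4·x(T_j)⟯ = ℚ⟮x(T_j)⟯`. [folklore] -/
theorem adjoin_four_mul_xT (j : Fin 3) : ℚ⟮4 * xT W two_ne_zero j⟯ = ℚ⟮xT W two_ne_zero j⟯ := by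
  refine le_antisymm (adjoin_simple_le_iff.mpr ?_) (adjoin_simple_le_iff.mpr ?_)
  · exact mul_mem (ofNat_mem _ 4) (mem_adjoin_simple_self ℚ _)
  · have hmem : (4 : AlgebraicClosure ℚ)⁻¹ * (4 * xT W two_ne_zero j) ∈ ℚ⟮4 * xT W two_ne_zero j⟯ :=
      mul_mem (inv_mem (ofNat_mem _ 4)) (mem_adjoin_simple_self ℚ _)
    rwa [← mul_assoc, inv_mul_cancel₀ (by norm_num), one_mul] at hmem

omit [W.IsElliptic] in
/-- The `u`-cubic `c_W` is monic of degree `3`. [folklore] -/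
theorem monic_twoDivisionUCubic_and_natDegree : (twoDivisionUCubic W).Monic ∧ (twoDivisionUCubic W).natDegree = 3 := by
  unfold twoDivisionUCubic
  exact ⟨by monicity!, by compute_degree!⟩

variable (ht : ∀ x : ℚ, ¬ HasRationalTwoTorsionX W x) {F : Type} [Field F] [NumberField F]
  (hF : Module.finrank ℚ F = 3) {e : F} (he : aeval e (twoDivisionUCubic W) = 0)

include ht in
/-- **`minpoly_ℚ(4·x(T_j)) = c_W`** (no rational `2`-torsion abscissa): `c_W` is monic with root `4·x(T_j)`, so `minpoly ∣ c_W`; both have degree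
`3` because `[ℚ⟮x(T_j)⟯ : ℚ] = 3` (irreducible `W[2]`, tree `finrank_adjoin_root_twoTorsionPolynomial_eq_three`). [cite: SilvermanAEC2009, III.2.3] -/
theorem minpoly_four_mul_xT (j : Fin 3) : minpoly ℚ (4 * xT W two_ne_zero j) = twoDivisionUCubic W := by
  obtain ⟨hmon, hdeg⟩ := monic_twoDivisionUCubic_and_natDegree W
  have hx : _root_.IsIntegral ℚ (4 * xT W two_ne_zero j) := ((AlgebraicClosure.isAlgebraic ℚ).isAlgebraic _).isIntegral
  have hβ : aeval (xT W two_ne_zero j) W.twoTorsionPolynomial.toPoly = 0 :=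
    (mem_rootSet_of_ne (twoTorsionPolynomial_toPoly_ne_zero W two_ne_zero)).mp (xT_mem_rootSet W two_ne_zero j)
  have h3 : (minpoly ℚ (4 * xT W two_ne_zero j)).natDegree = 3 := by
    rw [← IntermediateField.adjoin.finrank hx, adjoin_four_mul_xT W j]
    exact AddKatoTwo.finrank_adjoin_root_twoTorsionPolynomial_eq_three W
      (AlignedTransportAtTwoSeed.irr_two_of_forall_not_hasRationalTwoTorsionX W ht) hβ
  exact (eq_of_monic_of_dvd_of_natDegree_le (minpoly.monic hx) hmon (minpoly.dvd ℚ _ (aeval_four_mul_xT_twoDivisionUCubic W j))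
    (by rw [h3, hdeg])).symm

include ht in
/-- `E(ℚ)[2] = 0` ⟹ the `u`-cubic `c_W` is irreducible over `ℚ` (it is a minimal polynomial). [cite: SilvermanAEC2009, III.2.3] -/
theorem irreducible_twoDivisionUCubic' : Irreducible (twoDivisionUCubic W) := by
  rw [← minpoly_four_mul_xT W ht 0]
  exact minpoly.irreducible ((AlgebraicClosure.isAlgebraic ℚ).isAlgebraic _).isIntegral

include ht he in
/-- `minpoly_ℚ(e) = c_W` for every root `e` of the irreducible monic `c_W` in any field. [folklore] -/
theorem minpoly_eq_twoDivisionUCubic' : minpoly ℚ e = twoDivisionUCubic W :=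
  (minpoly.eq_of_irreducible_of_monic (irreducible_twoDivisionUCubic' W ht) he (monic_twoDivisionUCubic_and_natDegree W).1).symm

include ht hF he in
/-- `F = ℚ(e)`: a root of the irreducible cubic `c_W` generates the cubic field. [cite: MilneFT2022, Ch. 3] -/
theorem adjoin_root_eq_top : ℚ⟮e⟯ = ⊤ := by
  rw [Field.primitive_element_iff_minpoly_natDegree_eq, minpoly_eq_twoDivisionUCubic' W ht he,
    (monic_twoDivisionUCubic_and_natDegree W).2, hF]

include ht hF he in
/-- ★ **`ℚ⟮x(T_j)⟯ ≃ₐ[ℚ] F`** for every `j`: the cubic point field of `W` modelled in `ℚ̄` is isomorphic to ANY cubic number field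
containing a root of the `u`-cubic of `W` (`4·x(T_j)` and `e` have the same minimal polynomial `c_W`; `F = ℚ(e)`).
[cite: MilneFT2022, Ch. 3] [cite: SilvermanAEC2009, VIII.§1] -/
theorem nonempty_algEquiv_adjoin_xT (j : Fin 3) : Nonempty (↥ℚ⟮xT W two_ne_zero j⟯ ≃ₐ[ℚ] F) := by
  have hx : _root_.IsIntegral ℚ (4 * xT W two_ne_zero j) := ((AlgebraicClosure.isAlgebraic ℚ).isAlgebraic _).isIntegral
  have heI : _root_.IsIntegral ℚ e := IsIntegral.of_finite ℚ e
  have hmin : minpoly ℚ (4 * xT W two_ne_zero j) = minpoly ℚ e := by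
    rw [minpoly_four_mul_xT W ht, minpoly_eq_twoDivisionUCubic' W ht he]
  exact ⟨(equivOfEq (adjoin_four_mul_xT W j)).symm.trans <| (adjoinRootEquivAdjoin ℚ hx).symm.trans <|
    (AdjoinRoot.algEquivOfEq ℚ _ _ hmin).trans <| (adjoinRootEquivAdjoin ℚ heI).trans <|
    (equivOfEq (adjoin_root_eq_top W ht hF he)).trans topEquiv⟩

include ht he in
/-- The images of `e` under the embeddings `F →ₐ[ℚ] ℚ̄` are exactly the `4z` with `z` a root of the `2`-division cubic of `W` in `ℚ̄`.
[cite: MilneFT2022, Ch. 3] -/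
theorem mem_rootSet_twoTorsionPolynomial_iff_exists_algHom (z : AlgebraicClosure ℚ) :
    z ∈ W.twoTorsionPolynomial.toPoly.rootSet (AlgebraicClosure ℚ) ↔ ∃ f : F →ₐ[ℚ] AlgebraicClosure ℚ, f e = 4 * z := by
  have hrange := Algebra.IsAlgebraic.range_eval_eq_rootSet_minpoly (F := ℚ) (A := AlgebraicClosure ℚ) e
  rw [minpoly_eq_twoDivisionUCubic' W ht he] at hrange
  rw [mem_rootSet_twoTorsionPolynomial_iff, ← mem_rootSet_of_ne (monic_twoDivisionUCubic_and_natDegree W).1.ne_zero, ← hrange,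
    Set.mem_range]

include ht hF he in
/-- ★ **`ℚ(W[2])` is the normal closure of `F` in `ℚ̄`**: `W.divisionField 2 = normalClosure ℚ F ℚ̄ = ⨆_{f : F →ₐ[ℚ] ℚ̄} f(F)` — the
`2`-division field is the compositum of the three conjugates of the cubic field (att-p5 g6: `ℚ(W[2]) = ℚ(roots of ψ_W)`; the roots are the
`f(e)/4`). [cite: SilvermanAEC2009, VIII.§1] [cite: MilneFT2022, Ch. 5] -/
theorem divisionField_two_eq_normalClosure : W.divisionField 2 = normalClosure ℚ F (AlgebraicClosure ℚ) := by
  rw [divisionField_two_eq_adjoin_rootSet W]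
  refine le_antisymm (adjoin_le_iff.mpr fun z hz ↦ ?_) (normalClosure_le_iff.mpr fun f ↦ ?_)
  · obtain ⟨f, hf⟩ := (mem_rootSet_twoTorsionPolynomial_iff_exists_algHom W ht he z).mp hz
    have hz' : z = f ((4 : F)⁻¹ * e) := by
      rw [map_mul, map_inv₀, map_ofNat, hf, ← mul_assoc, inv_mul_cancel₀ (by norm_num), one_mul]
    rw [hz']
    exact AlgHom.fieldRange_le_normalClosure f ⟨_, rfl⟩
  · rw [AlgHom.fieldRange_eq_map, ← adjoin_root_eq_top W ht hF he, adjoin_map, Set.image_singleton, adjoin_simple_le_iff]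
    have hmem : (4 : AlgebraicClosure ℚ)⁻¹ * f e ∈ W.twoTorsionPolynomial.toPoly.rootSet (AlgebraicClosure ℚ) :=
      (mem_rootSet_twoTorsionPolynomial_iff_exists_algHom W ht he _).mpr ⟨f, by
        rw [← mul_assoc, mul_inv_cancel₀ (by norm_num), one_mul]⟩
    have h4 : f e = 4 * ((4 : AlgebraicClosure ℚ)⁻¹ * f e) := by
      rw [← mul_assoc, mul_inv_cancel₀ (by norm_num), one_mul]
    rw [h4]
    exact mul_mem (by exact_mod_cast (IntermediateField.adjoin ℚ _).algebraMap_mem 4) (subset_adjoin ℚ _ hmem)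

end OneCurve

/-! ## §2 Two curves sharing a cubic field (crux C1's binders) -/

section Shared

variable (W₁ W₂ : WeierstrassCurve ℚ) [W₁.IsElliptic] [W₂.IsElliptic]
  (ht₁ : ∀ x : ℚ, ¬ HasRationalTwoTorsionX W₁ x) (ht₂ : ∀ x : ℚ, ¬ HasRationalTwoTorsionX W₂ x)
  {F : Type} [Field F] [NumberField F] (hF : Module.finrank ℚ F = 3) {e₁ e₂ : F}
  (he₁ : aeval e₁ (twoDivisionUCubic W₁) = 0) (he₂ : aeval e₂ (twoDivisionUCubic W₂) = 0)

include ht₁ ht₂ hF he₁ he₂ in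
/-- ★★ **ONE SEXTIC: `ℚ(W₁[2]) = ℚ(W₂[2])` in `ℚ̄`** for two curves without rational `2`-torsion abscissa sharing a cubic field `F`
(C1's binders: `[F : ℚ] = 3`, `e_i ∈ F` a root of the `u`-cubic of `W_i`): both are the normal closure of `F` in `ℚ̄` (§1).
[cite: SilvermanAEC2009, VIII.§1] [cite: MilneFT2022, Ch. 5] -/
theorem divisionField_two_eq_of_shared_cubic_field : W₁.divisionField 2 = W₂.divisionField 2 := by
  rw [divisionField_two_eq_normalClosure W₁ ht₁ hF he₁, divisionField_two_eq_normalClosure W₂ ht₂ hF he₂]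

include ht₁ ht₂ hF he₁ he₂ in
/-- ★ **ONE CUBIC FIELD: `ℚ⟮x(T_j(W₁))⟯ ≃ₐ[ℚ] ℚ⟮x(T_j'(W₂))⟯`** for all `j, j'` (both `≃ F`, §1). [cite: MilneFT2022, Ch. 3] -/
theorem nonempty_algEquiv_adjoin_xT_adjoin_xT (j j' : Fin 3) :
    Nonempty (↥ℚ⟮xT W₁ two_ne_zero j⟯ ≃ₐ[ℚ] ↥ℚ⟮xT W₂ two_ne_zero j'⟯) := by
  obtain ⟨⟨φ₁⟩, ⟨φ₂⟩⟩ := And.intro (nonempty_algEquiv_adjoin_xT W₁ ht₁ hF he₁ j) (nonempty_algEquiv_adjoin_xT W₂ ht₂ hF he₂ j')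
  exact ⟨φ₁.trans φ₂.symm⟩

end Shared

/-! ## §3 Consequences: every Iwasawa input of C2 agrees on `W₁` and `W₂` (and can be read on `F`) -/

section CurrencyOne

variable (W : WeierstrassCurve ℚ) [W.IsElliptic] (ht : ∀ x : ℚ, ¬ HasRationalTwoTorsionX W x)
  {F : Type} [Field F] [NumberField F] (hF : Module.finrank ℚ F = 3) {e : F} (he : aeval e (twoDivisionUCubic W) = 0)

include ht hF he in
/-- **The cubic input can be read on `F`: `e_n(F) = e_n(ℚ(β_j))` for every `n`** (cyclotomic `ℤ₂`-towers of `F` and of the cubic point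
field `ℚ⟮x(T_j)⟯ ⊆ ℚ̄`, any normalisations): both are restrictions of the cyclotomic tower of `ℚ` (`2 ∤ 3`), transported along §1's
`ℚ⟮x(T_j)⟯ ≃ₐ[ℚ] F`. [cite: Washington1997, §13.1] -/
theorem classNumberPExp_eq_adjoin_xT_of_root (j : Fin 3) (κF : ZpExtension F 2) (hκF : κF.IsCyclotomic)
    (κj : ZpExtension ↥ℚ⟮xT W two_ne_zero j⟯ 2) (hκj : κj.IsCyclotomic) (n : ℕ) :
    classNumberPExp κF n = classNumberPExp κj n := by
  haveI : FiniteDimensional ℚ ↥ℚ⟮xT W two_ne_zero j⟯ := adjoin.finiteDimensional ((AlgebraicClosure.isAlgebraic ℚ).isAlgebraic _).isIntegral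
  haveI : NumberField ↥ℚ⟮xT W two_ne_zero j⟯ := NumberField.mk
  obtain ⟨κ, hκ⟩ := exists_cyclotomicZpExtension_holds ℚ 2
  obtain ⟨φ⟩ := nonempty_algEquiv_adjoin_xT W ht hF he j
  have hj := surjective_cubic_restrict W ht κ j
  have hFs : Function.Surjective (κ.toContinuousMonoidHom.comp (absGaloisRestrict ℚ F)) :=
    surjective_comp_absGaloisRestrict_of_not_dvd_finrank κ F (by rw [hF]; decide)
  rw [classNumberPExp_eq_of_isCyclotomic κF (κ.restrict _ hFs) hκF (isCyclotomic_restrict κ hκ _ hFs) n,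
    classNumberPExp_eq_of_isCyclotomic κj (κ.restrict _ hj) hκj (isCyclotomic_restrict κ hκ _ hj) n]
  exact (classNumberPExp_restrict_eq_of_algEquiv κ φ hj hFs n).symm

include ht hF he in
/-- **H3M read on `F`**: `μ₂ = 0` (growth form) for the cyclotomic `ℤ₂`-towers of `F` iff for those of the cubic point field `ℚ⟮x(T_j)⟯`.
[cite: Washington1997, §13.1] [cite: RaySujatha2021, §1 eq. (1.1)] -/
theorem forall_classicalMuVanishes_iff_adjoin_xT_of_root (j : Fin 3) :
    (∀ κF : ZpExtension F 2, κF.IsCyclotomic → ClassicalMuVanishes κF) ↔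
      ∀ κj : ZpExtension ↥ℚ⟮xT W two_ne_zero j⟯ 2, κj.IsCyclotomic → ClassicalMuVanishes κj := by
  haveI : FiniteDimensional ℚ ↥ℚ⟮xT W two_ne_zero j⟯ := adjoin.finiteDimensional ((AlgebraicClosure.isAlgebraic ℚ).isAlgebraic _).isIntegral
  haveI : NumberField ↥ℚ⟮xT W two_ne_zero j⟯ := NumberField.mk
  constructor
  · intro h κj hκj; obtain ⟨l, ν, n₀, hg⟩ := h _ (exists_cyclotomicZpExtension_holds F 2).choose_spec
    exact ⟨l, ν, n₀, fun n hn ↦ by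
      rw [← classNumberPExp_eq_adjoin_xT_of_root W ht hF he j _ (exists_cyclotomicZpExtension_holds F 2).choose_spec κj hκj n]
      exact hg n hn⟩
  · intro h κF hκF; obtain ⟨l, ν, n₀, hg⟩ := h _ (exists_cyclotomicZpExtension_holds ↥ℚ⟮xT W two_ne_zero j⟯ 2).choose_spec
    exact ⟨l, ν, n₀, fun n hn ↦ by
      rw [classNumberPExp_eq_adjoin_xT_of_root W ht hF he j κF hκF _
        (exists_cyclotomicZpExtension_holds ↥ℚ⟮xT W two_ne_zero j⟯ 2).choose_spec n]
      exact hg n hn⟩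

end CurrencyOne

section CurrencyShared

variable (W₁ W₂ : WeierstrassCurve ℚ) [W₁.IsElliptic] [W₂.IsElliptic]
  (ht₁ : ∀ x : ℚ, ¬ HasRationalTwoTorsionX W₁ x) (ht₂ : ∀ x : ℚ, ¬ HasRationalTwoTorsionX W₂ x)
  {F : Type} [Field F] [NumberField F] (hF : Module.finrank ℚ F = 3) {e₁ e₂ : F}
  (he₁ : aeval e₁ (twoDivisionUCubic W₁) = 0) (he₂ : aeval e₂ (twoDivisionUCubic W₂) = 0)

include ht₁ ht₂ hF he₁ he₂ in
/-- ★ **ONE CUBIC INPUT: `e_n(ℚ(β(W₁))) = e_n(ℚ(β(W₂)))` for every `n`** (any roots `j, j'`, any cyclotomic `ℤ₂`-towers) on C1's binders.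
[cite: Washington1997, §13.1] -/
theorem classNumberPExp_adjoin_xT_eq_of_shared_cubic_field (j j' : Fin 3)
    (κ₁ : ZpExtension ↥ℚ⟮xT W₁ two_ne_zero j⟯ 2) (hκ₁ : κ₁.IsCyclotomic)
    (κ₂ : ZpExtension ↥ℚ⟮xT W₂ two_ne_zero j'⟯ 2) (hκ₂ : κ₂.IsCyclotomic) (n : ℕ) :
    classNumberPExp κ₁ n = classNumberPExp κ₂ n := by
  obtain ⟨κF, hκF⟩ := exists_cyclotomicZpExtension_holds F 2
  rw [← classNumberPExp_eq_adjoin_xT_of_root W₁ ht₁ hF he₁ j κF hκF κ₁ hκ₁ n,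
    classNumberPExp_eq_adjoin_xT_of_root W₂ ht₂ hF he₂ j' κF hκF κ₂ hκ₂ n]

include ht₁ ht₂ hF he₁ he₂ in
/-- ★ **H3M agrees on the pair**: `μ₂ = 0` for the cyclotomic `ℤ₂`-towers of `ℚ(β(W₁))` iff of `ℚ(β(W₂))` (C1's binders; road (b″)'s
open input on `Δ < 0`, att-p3 g34's price list). [cite: Washington1997, §13.1] [cite: RaySujatha2021, §1 eq. (1.1)] -/
theorem forall_classicalMuVanishes_adjoin_xT_iff_of_shared_cubic_field (j j' : Fin 3) :
    (∀ κ₁ : ZpExtension ↥ℚ⟮xT W₁ two_ne_zero j⟯ 2, κ₁.IsCyclotomic → ClassicalMuVanishes κ₁) ↔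
      ∀ κ₂ : ZpExtension ↥ℚ⟮xT W₂ two_ne_zero j'⟯ 2, κ₂.IsCyclotomic → ClassicalMuVanishes κ₂ := by
  rw [← forall_classicalMuVanishes_iff_adjoin_xT_of_root W₁ ht₁ hF he₁ j,
    forall_classicalMuVanishes_iff_adjoin_xT_of_root W₂ ht₂ hF he₂ j']

include ht₁ ht₂ hF he₁ he₂ in
/-- ★★ **ONE SEXTIC TABLE: `e_n(ℚ(W₁[2])) = e_n(ℚ(W₂[2]))` for every `n`** (any cyclotomic `ℤ₂`-towers of the two `2`-division fields):
the fields coincide in `ℚ̄` (§2) and `e_n` does not depend on the normalisation. [cite: Washington1997, §13.1] -/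
theorem classNumberPExp_divisionField_two_eq_of_shared_cubic_field
    (κ₁ : ZpExtension ↥(W₁.divisionField 2) 2) (hκ₁ : κ₁.IsCyclotomic)
    (κ₂ : ZpExtension ↥(W₂.divisionField 2) 2) (hκ₂ : κ₂.IsCyclotomic) (n : ℕ) :
    classNumberPExp κ₁ n = classNumberPExp κ₂ n := by
  have hdiv := divisionField_two_eq_of_shared_cubic_field W₁ W₂ ht₁ ht₂ hF he₁ he₂
  suffices h : ∀ (T : IntermediateField ℚ (AlgebraicClosure ℚ)) (hT : T = W₂.divisionField 2)
      (κ : ZpExtension ↥T 2), κ.IsCyclotomic → classNumberPExp κ n = classNumberPExp κ₂ n from h _ hdiv κ₁ hκ₁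
  rintro T rfl κ hκ
  exact classNumberPExp_eq_of_isCyclotomic κ κ₂ hκ hκ₂ n

include ht₁ ht₂ hF he₁ he₂ in
/-- **`μ₂(ℚ(W₁[2])) = 0 ⟺ μ₂(ℚ(W₂[2])) = 0`** (growth form, any cyclotomic `ℤ₂`-towers) on C1's binders.
[cite: RaySujatha2021, §1 eq. (1.1)] [cite: Washington1997, §13.1] -/
theorem classicalMuVanishes_divisionField_two_iff_of_shared_cubic_field
    (κ₁ : ZpExtension ↥(W₁.divisionField 2) 2) (hκ₁ : κ₁.IsCyclotomic)
    (κ₂ : ZpExtension ↥(W₂.divisionField 2) 2) (hκ₂ : κ₂.IsCyclotomic) :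
    ClassicalMuVanishes κ₁ ↔ ClassicalMuVanishes κ₂ := by
  simp only [ClassicalMuVanishes,
    classNumberPExp_divisionField_two_eq_of_shared_cubic_field W₁ W₂ ht₁ ht₂ hF he₁ he₂ κ₁ hκ₁ κ₂ hκ₂]

include ht₁ ht₂ hF he₁ he₂ in
/-- **`λ₂(ℚ(W₁[2])) = λ₂(ℚ(W₂[2]))`** (the tree's growth-form `classicalLambda`, any cyclotomic `ℤ₂`-towers) on C1's binders — the
sextic `λ₂`-table of the C2 ledger (att-p4 g29 rows III, att-p3 g33/g34) is indexed by the cubic field. [cite: Washington1997, §13.3 Thm. 13.13] -/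
theorem classicalLambda_divisionField_two_eq_of_shared_cubic_field
    (κ₁ : ZpExtension ↥(W₁.divisionField 2) 2) (hκ₁ : κ₁.IsCyclotomic)
    (κ₂ : ZpExtension ↥(W₂.divisionField 2) 2) (hκ₂ : κ₂.IsCyclotomic) :
    classicalLambda κ₁ = classicalLambda κ₂ := by
  have hdiv := divisionField_two_eq_of_shared_cubic_field W₁ W₂ ht₁ ht₂ hF he₁ he₂
  suffices h : ∀ (T : IntermediateField ℚ (AlgebraicClosure ℚ)) (hT : T = W₂.divisionField 2)
      (κ : ZpExtension ↥T 2), κ.IsCyclotomic → classicalLambda κ = classicalLambda κ₂ from h _ hdiv κ₁ hκ₁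
  rintro T rfl κ hκ
  exact classicalLambda_eq_of_isCyclotomic κ κ₂ hκ hκ₂

include ht₁ ht₂ hF he₁ he₂ in
/-- **The sextic input agrees on the pair** (`∀` cyclotomic towers form, as in the lead's sextic criterion / necessity files).
[cite: RaySujatha2021, §1 eq. (1.1)] -/
theorem forall_classicalMuVanishes_divisionField_two_iff_of_shared_cubic_field :
    (∀ κ₁ : ZpExtension ↥(W₁.divisionField 2) 2, κ₁.IsCyclotomic → ClassicalMuVanishes κ₁) ↔
      ∀ κ₂ : ZpExtension ↥(W₂.divisionField 2) 2, κ₂.IsCyclotomic → ClassicalMuVanishes κ₂ := by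
  rw [divisionField_two_eq_of_shared_cubic_field W₁ W₂ ht₁ ht₂ hF he₁ he₂]

include ht₁ ht₂ hF he₁ he₂ in
/-- ★★ **THE PFμ⁺ CONCLUSION AGREES ON THE PAIR**: for every `K ⊆ ℚ̄` (the registered stub `PointFieldMuCycAtTwo` takes `K = ℚ⟮i⟯`, `i² = −1`,
carrier `ℚ(W[2]) ⊔ ℚ⟮i⟯` VERBATIM), `μ₂ = 0` for every cyclotomic `ℤ₂`-tower of `ℚ(W₁[2]) ⊔ K` iff of `ℚ(W₂[2]) ⊔ K` (C1's binders).
[cite: RaySujatha2021, §1 eq. (1.1)] [cite: Iwasawa1973MuInvariants, §1 (shape only)] -/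
theorem forall_classicalMuVanishes_sup_iff_of_shared_cubic_field (K : IntermediateField ℚ (AlgebraicClosure ℚ)) :
    (∀ κ₁ : ZpExtension ↥(W₁.divisionField 2 ⊔ K) 2, κ₁.IsCyclotomic → ClassicalMuVanishes κ₁) ↔
      ∀ κ₂ : ZpExtension ↥(W₂.divisionField 2 ⊔ K) 2, κ₂.IsCyclotomic → ClassicalMuVanishes κ₂ := by
  rw [divisionField_two_eq_of_shared_cubic_field W₁ W₂ ht₁ ht₂ hF he₁ he₂]

include ht₁ ht₂ hF he₁ he₂ in
/-- **`e_n` of the PFμ⁺ carriers agree**: `e_n(ℚ(W₁[2]) ⊔ K) = e_n(ℚ(W₂[2]) ⊔ K)` for every `n`, any `K ⊆ ℚ̄`, any cyclotomic `ℤ₂`-towers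
(so also `λ₂` and `μ₂`-vanishing of `ℚ(W[2], i)`). [cite: Washington1997, §13.1] -/
theorem classNumberPExp_sup_eq_of_shared_cubic_field (K : IntermediateField ℚ (AlgebraicClosure ℚ))
    (κ₁ : ZpExtension ↥(W₁.divisionField 2 ⊔ K) 2) (hκ₁ : κ₁.IsCyclotomic)
    (κ₂ : ZpExtension ↥(W₂.divisionField 2 ⊔ K) 2) (hκ₂ : κ₂.IsCyclotomic) (n : ℕ) :
    classNumberPExp κ₁ n = classNumberPExp κ₂ n := by
  have hdiv := divisionField_two_eq_of_shared_cubic_field W₁ W₂ ht₁ ht₂ hF he₁ he₂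
  suffices h : ∀ (T : IntermediateField ℚ (AlgebraicClosure ℚ)) (hT : T = W₂.divisionField 2)
      (κ : ZpExtension ↥(T ⊔ K) 2), κ.IsCyclotomic → classNumberPExp κ n = classNumberPExp κ₂ n from h _ hdiv κ₁ hκ₁
  rintro T rfl κ hκ
  exact classNumberPExp_eq_of_isCyclotomic κ κ₂ hκ hκ₂ n

include ht₁ ht₂ hF he₁ he₂ in
/-- ★ **ONE RESOLVENT TABLE: `e_n(ℚ(√Δ(W₁))) = e_n(ℚ(√Δ(W₂)))` for every `n`** (resolvent models `ℚ⟮4δ⟯ ⊆ ℚ̄`, `(4δ)² = Δ`, any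
cyclotomic `ℤ₂`-towers), for `Δ(W_i) ∉ ℚ²`, `2Δ(W_i) ∉ ℚ²` (automatic on C2's binders): by this seat's EXACT `S₃` identity (g30
`classNumberPExp_divisionField_two_eq_resolvent_add_two_mul_cubic`: `e_n(T) = e_n(ℚ(√Δ)) + 2e_n(ℚ(β))`) and the two transports above —
no identification of the two resolvent fields is needed. [cite: CaputoNuccio2020, Prop. 3.12] [cite: Washington1997, §13.1] -/
theorem classNumberPExp_resolvent_eq_of_shared_cubic_field (hsq₁ : ¬ IsSquare W₁.Δ) (h2Δ₁ : ¬ IsSquare (2 * W₁.Δ))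
    (hsq₂ : ¬ IsSquare W₂.Δ) (h2Δ₂ : ¬ IsSquare (2 * W₂.Δ)) (j : Fin 3)
    (κT₁ : ZpExtension ↥(W₁.divisionField 2) 2) (hκT₁ : κT₁.IsCyclotomic)
    (κT₂ : ZpExtension ↥(W₂.divisionField 2) 2) (hκT₂ : κT₂.IsCyclotomic)
    (κK₁ : ZpExtension ↥ℚ⟮xT W₁ two_ne_zero j⟯ 2) (hκK₁ : κK₁.IsCyclotomic)
    (κK₂ : ZpExtension ↥ℚ⟮xT W₂ two_ne_zero j⟯ 2) (hκK₂ : κK₂.IsCyclotomic)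
    (κk₁ : ZpExtension ↥ℚ⟮4 * delta W₁ two_ne_zero⟯ 2) (hκk₁ : κk₁.IsCyclotomic)
    (κk₂ : ZpExtension ↥ℚ⟮4 * delta W₂ two_ne_zero⟯ 2) (hκk₂ : κk₂.IsCyclotomic) (n : ℕ) :
    classNumberPExp κk₁ n = classNumberPExp κk₂ n := by
  have h₁ := classNumberPExp_divisionField_two_eq_resolvent_add_two_mul_cubic W₁ ht₁ hsq₁ h2Δ₁ j κT₁ hκT₁ κk₁ hκk₁ κK₁ hκK₁ n
  have h₂ := classNumberPExp_divisionField_two_eq_resolvent_add_two_mul_cubic W₂ ht₂ hsq₂ h2Δ₂ j κT₂ hκT₂ κk₂ hκk₂ κK₂ hκK₂ n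
  have hT := classNumberPExp_divisionField_two_eq_of_shared_cubic_field W₁ W₂ ht₁ ht₂ hF he₁ he₂ κT₁ hκT₁ κT₂ hκT₂ n
  have hK := classNumberPExp_adjoin_xT_eq_of_shared_cubic_field W₁ W₂ ht₁ ht₂ hF he₁ he₂ j j κK₁ hκK₁ κK₂ hκK₂ n
  omega


include ht₁ ht₂ hF he₁ he₂ in
/-- **The resolvent table on the cruxes' own binders** (`W_i` globally minimal and good ordinary at `2`: then `2Δ(W_i) ∉ ℚ²`, att-p4 g29
`not_isSquare_two_mul_Δ_of_isOrdinaryAt`; `Δ(W₁) ∉ ℚ²` follows from `Δ(W₂) ∉ ℚ²` on C1's binders by att-p1's `not_isSquare_Δ_of_shared_cubic_field`,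
kept as a hypothesis here to stay route-independent): `e_n(ℚ(√Δ(W₁))) = e_n(ℚ(√Δ(W₂)))` for every `n`.
[cite: CaputoNuccio2020, Prop. 3.12] [cite: Washington1997, §13.1] -/
theorem classNumberPExp_resolvent_eq_of_shared_cubic_field_of_isOrdinaryAt [W₁.IsGloballyMinimal] [W₂.IsGloballyMinimal]
    (hord₁ : IsOrdinaryAt W₁ 2) (hord₂ : IsOrdinaryAt W₂ 2) (hsq₁ : ¬ IsSquare W₁.Δ) (hsq₂ : ¬ IsSquare W₂.Δ) (j : Fin 3)
    (κT₁ : ZpExtension ↥(W₁.divisionField 2) 2) (hκT₁ : κT₁.IsCyclotomic)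
    (κT₂ : ZpExtension ↥(W₂.divisionField 2) 2) (hκT₂ : κT₂.IsCyclotomic)
    (κK₁ : ZpExtension ↥ℚ⟮xT W₁ two_ne_zero j⟯ 2) (hκK₁ : κK₁.IsCyclotomic)
    (κK₂ : ZpExtension ↥ℚ⟮xT W₂ two_ne_zero j⟯ 2) (hκK₂ : κK₂.IsCyclotomic)
    (κk₁ : ZpExtension ↥ℚ⟮4 * delta W₁ two_ne_zero⟯ 2) (hκk₁ : κk₁.IsCyclotomic)
    (κk₂ : ZpExtension ↥ℚ⟮4 * delta W₂ two_ne_zero⟯ 2) (hκk₂ : κk₂.IsCyclotomic) (n : ℕ) :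
    classNumberPExp κk₁ n = classNumberPExp κk₂ n :=
  classNumberPExp_resolvent_eq_of_shared_cubic_field W₁ W₂ ht₁ ht₂ hF he₁ he₂ hsq₁ (not_isSquare_two_mul_Δ_of_isOrdinaryAt W₁ hord₁)
    hsq₂ (not_isSquare_two_mul_Δ_of_isOrdinaryAt W₂ hord₂) j κT₁ hκT₁ κT₂ hκT₂ κK₁ hκK₁ κK₂ hκK₂ κk₁ hκk₁ κk₂ hκk₂ n

end CurrencyShared

end Summit.BirchSwinnertonDyer.BirchSwinnertonDyer.Theorems.AlignedTransportAtTwoSharedCubicDivisionField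

end
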